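import Literature.MathematicalPhysics.QuantumFieldTheory.Balaban1983to89.B9Thm32Conv348AtKnitLetterOfRegYP335
import Literature.MathematicalPhysics.QuantumFieldTheory.Balaban1983to89.B9Thm311DeltaAQIsUnitAtKnitRecordOfSections
import Literature.MathematicalPhysics.QuantumFieldTheory.Balaban1983to89.B9Thm39FacesAtLettersRC

/-!
# `Balaban1983to89.B9KnitRows1517AtPinnedShapesY` — T. Bałaban, *Propagators for lattice gauge theories in a background field*, Commun. Math. Phys. **99** (1985)
# 389–434 [Balaban1985BackgroundPropagators], Thm 3.2 (3.48) p. 398 and Thm 3.11 p. 416 AT THE KNIT RECORD, IN THE CONSUMERS' PINNED BINDER SHAPES: rows 15–16's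
# display `h348` at a letters family `𝔏` PINNED to `(parKnitY, GpY parKnitY)` in the `oneCubeOps39YF ∕ oneCubeOps39YFR` typings (dag-n06-d's «KD» shape), and row 17's
# guarded unit `hunitA` at an averaging pair GIVEN BY ITS FACES `𝔮 j U = QknitY U`, `𝔮s j U = adjTrY (QknitY U)` (dag-n06-c's knit Sect.-B step shape) —
# bookkeeping corollaries of `B9Thm32Conv348AtKnitLetterOfRegYP335` and `B9Thm311DeltaAQIsUnitAtKnitRecordOfSections`, section-carrying members

statement-level skeleton of published theorems with citation tags; proofs where landed; nothing here is a claim about the Yang–Mills mass gap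

THE PRINT.  Thm 3.2 (3.48) p. 398, (3.96) p. 411 (the block majorant of `(Q′G′²Q′*)⁻¹`); Thm 3.11 p. 416 (positivity of `Δ_a`, hence invertibility); (3.26)–(3.27)
p. 395 (`Δ_a`, `G = Δ_a⁻¹`); (3.19) p. 393 (the knit transporters); (3.11)–(3.13) p. 392 and (3.14)–(3.15) p. 393 (the averaging pair); (3.35) p. 396 (the cube class); (3.115) p. 418 (print's `Q`);
[5] = *Averaging operations …*, Commun. Math. Phys. **98** (1985), (15)–(23) pp. 19–21, Prop. 2 (52)–(53) p. 26.

WHY THIS FILE (cell `pub-ymgap`, node N06, seat `dag-n06-j` gen 37 = bundle F5 rows 15–17; two live consumer shapes, 2026-08-30).  (i) referee dag-ref-A READ-15 on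
dag-n06-d's «KD» (`Thm/…N06AtOpsYSectEStKnitSectDKD`) records a DECLARED «KC» SEAM: «KA» displays `h348` as `Conv348Blk (oneCubeOps39 (geo9Y x) (bg9YR …) (blk39F … (bI x))
(L39 x (parKnitY x) (𝔏 x).Gp)) …` while «KD» consumes `Conv348Blk (oneCubeOps39YF θ M⋆ 𝔏 bI x) …` at the `bg9Y` typing with the letter pins `h𝔏P : (𝔏 x).parS = parKnitY x`,
`h𝔏Gp : (𝔏 x).Gp = GpY x (parKnitY x)`; `B9Thm32Conv348AtKnitLetterOfRegYP335` supplies the first shape (section-carrying members) — §1 supplies the second (and its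
`bg9YR` twin `oneCubeOps39YFR`), the two being definitionally one display once the pins are rewritten (`Conv348Blk` reads an `Ops39Blk` only through `.L U` and `.blk`;
`B9Thm39FacesAtLettersRC.conv348Blk_oneCubeYFR_iff`).  (ii) dag-n06-c's knit Sect.-B step `Thm/…N06SectBStepUParKnit.sectBStepUPar_knit_of_laws` (INTENT 2026-08-30) takes
its averaging pair `(𝔮, 𝔮s)` through the FACES `h𝔮 : 𝔮 j U = QknitY (f j).toKIdx U`, `h𝔮s : 𝔮s j U = adjTrY (QknitY (f j).toKIdx U)` and displays the guarded unit
`hunitA : … → IsUnit (deltaAQY (f j).toKIdx (𝔮 j) (𝔮s j) (parKnitY _) (GpY _ (parKnitY _)) U)`; `B9Thm311DeltaAQIsUnitAtKnitRecordOfSections.hunitAQ_knitRecord_of_sections`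
supplies it at the literal pair of record `(qKnitOfRecord, qsKnitOfRecord)` — §2 supplies it at any face-given pair, since `deltaAQY i 𝔮 𝔮s parS Gp U` reads the pair only
through `𝔮 U`, `𝔮s U` ((3.26): `Δ + D_U R(U) D*_U + 𝔮⋆(U) a 𝔮(U)`).

WHAT IS PROVED (sorry-free; 0 `def`; bookkeeping only).
* §1 `conv348_oneCubeYFR_knitPins_of_regYR_section` ∕ `conv348_oneCubeYF_knitPins_of_regYR_section` — rows 15–16's display in the `oneCubeOps39YFR` ∕ `oneCubeOps39YF` typings
  at a letters family pinned to `(parKnitY, GpY parKnitY)`, R-generic premise (`0 < c`, `hRP1`, guard `c·M·α₀ ≤ a₁`), section-carrying members.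
* §2 ★★ `hunitAQ_knitFaces_of_sections` — n06-c's `hunitA` binder VERBATIM at `G := SU(N)`, `c35 := c35Y`, for a face-given pair, along every sub-family with sections.
HONEST SCOPE.  Re-typings of landed theorems; no estimate of [B9] asserted or re-proved; inner-corner members (no section) stay outside; helper, count-neutral; N06 NOT
discharged; nothing continuum ∕ OS ∕ mass gap ∕ Clay — the Yang–Mills mass gap is NOT proved here.  No `sorry`, no `axiom`, no `instance`, no `notation`, no `def`.  NEW file.
RELATED, NOT DUPLICATED (searched 2026-08-30: `rg -l -w "KnitRows1517|hunitAQ_knitFaces_of_sections|conv348_oneCubeYF_knitPins_of_regYR_section"` over `lean/{Literature,Summits,HarnessLib}` = ∅):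
the two parents above (USED); `B9Thm39FacesAtLettersRC` (the typing bridges, `Iff.rfl`); n06-c `B9SectBStepUParGQOfMembers` ∕ n06-d «KA»∕«KD» (the consumers).
-/

noncomputable section

namespace Literature.MathematicalPhysics.QuantumFieldTheory.Balaban1983to89.B9KnitRows1517AtPinnedShapesY

open Literature.MathematicalPhysics.QuantumFieldTheory.Balaban1983to89
open Node00 B9Thm39WholeBlk B9Thm39ReadingCoords B9Thm39ReadingAtLetters B9Thm39OneCubeReadingAtLettersY B9Thm39PureGaugeClassAtLettersR
  B6KLevelCensusIndexV1 B6Ineq2142KLevelV1 B6GlobalChartV1 B9PinMembersKLevelV1 B9PinGeometryKLevelV1 B9GeoNormsKLevelV1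
  B9BackgroundsKLevelV1 B9BackgroundsKLevelV1P B9BackgroundsKLevelV1R B7Prop2SpecialUnitary
open Literature.MathematicalPhysics.QuantumFieldTheory.Balaban1983to89.B9Ineq349SiteFromConv348 (blk39F)
open Literature.MathematicalPhysics.QuantumFieldTheory.Balaban1983to89.B9SectBCodedClassR (bg9YC extraYPb)
open Literature.MathematicalPhysics.QuantumFieldTheory.Balaban1983to89.B9B8AveragingJunction (parKnitY)
open Literature.MathematicalPhysics.QuantumFieldTheory.Balaban1983to89.B9Eq3115KnitLetterY (QknitY)
open Literature.MathematicalPhysics.QuantumFieldTheory.Balaban1983to89.Node00.OpsYQLetter (qKnitOfRecord qsKnitOfRecord adjTrY)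
open Literature.MathematicalPhysics.QuantumFieldTheory.Balaban1983to89.B9Thm32Conv348AtKnitLetterOfRegYP335 (conv348_oneCube_parKnitY_of_regYR_section)
open Literature.MathematicalPhysics.QuantumFieldTheory.Balaban1983to89.B9Thm311DeltaAQIsUnitAtKnitRecordOfSections (isUnit_deltaAQY_knitRecord_at_scMember)
open scoped Matrix.Norms.L2Operator

variable {N : ℕ} (θ : Stage3Params) (Mstar : ℕ)

/-! ## §1 Rows 15–16's display in the `oneCubeOps39YF(R)` typings at letters pinned to the knit pair (dag-n06-d «KD»'s shape) -/

section Rows1516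

variable [∀ x : MemberY θ.d₆ θ.ℓ₆ θ.hd' θ.hL' θ.b₀ θ.b₁ Mstar, Fintype (geo9Y x).Site]

/-- ★ **ROWS 15–16's DISPLAY IN THE `oneCubeOps39YFR` TYPING AT LETTERS PINNED TO `(parKnitY, GpY parKnitY)`**: for a letters family `𝔏` with the pins
`(𝔏 x).parS = parKnitY x` and `(𝔏 x).Gp = GpY x (parKnitY x)`, the R-generic premise (`0 < c`, `hRP1`) gives `M₁, a₁, B₀, δ₀ > 0` with
`Conv348Blk (oneCubeOps39YFR θ M⋆ 𝔏 R₁ R₂ bI x) B₀ δ₀ U` for every section-carrying member above `M₁`, every `α₀ > 0` with `c·M·α₀ ≦ a₁`, every `U` of the R-class.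
[cite: Balaban1985BackgroundPropagators, Thm 3.2 (3.48) p.398 + (3.96) p.411 + (3.19) p.393 + (3.35) p.396; Balaban1984PropagatorsII, (2.51) p.232 + (2.86) p.238 + p.248] -/
theorem conv348_oneCubeYFR_knitPins_of_regYR_section (hN : 1 ≤ N) (𝔏 : LettersY N θ Mstar)
    (hP : ∀ x : MemberY θ.d₆ θ.ℓ₆ θ.hd' θ.hL' θ.b₀ θ.b₁ Mstar, (𝔏 x).parS = parKnitY x.toKIdx)
    (hGp : ∀ x : MemberY θ.d₆ θ.ℓ₆ θ.hd' θ.hL' θ.b₀ θ.b₁ Mstar, (𝔏 x).Gp = GpY x.toKIdx (parKnitY x.toKIdx))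
    {R₁ R₂ : RegFamY θ.d₆ θ.ℓ₆ θ.hd' θ.hL' θ.b₀ θ.b₁ Mstar (Matrix (Fin N) (Fin N) ℂ)} {c : ℝ} (hc : 0 < c)
    (hRP1 : ∀ (x : MemberY θ.d₆ θ.ℓ₆ θ.hd' θ.hL' θ.b₀ θ.b₁ Mstar) (α₀ : ℝ)
      (U : (bg9YR (Matrix (Fin N) (Fin N) ℂ) (specialUnitaryUnits (Fin N)) R₁ R₂ x).Cfg),
      (bg9YR (Matrix (Fin N) (Fin N) ℂ) (specialUnitaryUnits (Fin N)) R₁ R₂ x).Reg335 c α₀ U →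
        0 ≤ α₀ ∧ (bg9YP (Matrix (Fin N) (Fin N) ℂ) (specialUnitaryUnits (Fin N)) x).Reg335 c35Y α₀ U) :
    ∃ M₁ a₁ B₀ δ₀ : ℝ, 0 < M₁ ∧ 0 < a₁ ∧ 0 < B₀ ∧ 0 < δ₀ ∧
    ∀ (bI : ∀ x : MemberY θ.d₆ θ.ℓ₆ θ.hd' θ.hL' θ.b₀ θ.b₁ Mstar, FBondY x.toKIdx → IBondY x.toKIdx)
      (_hβI : ∀ (x : MemberY θ.d₆ θ.ℓ₆ θ.hd' θ.hL' θ.b₀ θ.b₁ Mstar) (f : FBondY x.toKIdx) (c : IBondY x.toKIdx),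
        blkV1 x.hN x.D f = β x.hN x.D x.hk c → β x.hN x.D x.hk (bI x f) = blkV1 x.hN x.D f)
      (x : MemberY θ.d₆ θ.ℓ₆ θ.hd' θ.hL' θ.b₀ θ.b₁ Mstar), Function.Surjective (β x.hN x.D x.hk) → M₁ ≤ (geo9Y x).M →
      ∀ α₀ : ℝ, 0 < α₀ → c * (geo9Y x).M * α₀ ≤ a₁ →
      ∀ U : (bg9YR (Matrix (Fin N) (Fin N) ℂ) (specialUnitaryUnits (Fin N)) R₁ R₂ x).Cfg,
        (bg9YR (Matrix (Fin N) (Fin N) ℂ) (specialUnitaryUnits (Fin N)) R₁ R₂ x).Reg335 c α₀ U →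
        Conv348Blk (oneCubeOps39YFR θ Mstar 𝔏 R₁ R₂ bI x) B₀ δ₀ U := by
  obtain ⟨M₁, a₁, B₀, δ₀, hM₁, ha₁, hB₀, hδ₀, h⟩ := conv348_oneCube_parKnitY_of_regYR_section (N := N) θ Mstar hN hc hRP1
  refine ⟨M₁, a₁, B₀, δ₀, hM₁, ha₁, hB₀, hδ₀, fun bI hβI x hsurj hM α₀ hα ha U hU => ?_⟩
  show Conv348Blk (oneCubeOps39 (geo9Y x) (bg9YR (Matrix (Fin N) (Fin N) ℂ) (specialUnitaryUnits (Fin N)) R₁ R₂ x)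
    (blk39F (Matrix (Fin N) (Fin N) ℂ) x.toKIdx (bI x)) (L39 x.toKIdx (𝔏 x).parS (𝔏 x).Gp)) B₀ δ₀ U
  rw [hP x, hGp x]
  exact h bI hβI x hsurj hM α₀ hα ha U hU

/-- ★ **THE SAME IN THE `oneCubeOps39YF` TYPING (`bg9Y`)** — dag-n06-d «KD»'s literal `Conv348Blk (oneCubeOps39YF θ M⋆ 𝔏 bI x) B₃₉ δ₃₉ U`; the two typings are one display
(`B9Thm39FacesAtLettersRC.conv348Blk_oneCubeYFR_iff`, `Iff.rfl`). [cite: Balaban1985BackgroundPropagators, Thm 3.2 (3.48) p.398 + (3.96) p.411 + (3.19) p.393 + (3.35) p.396; Balaban1984PropagatorsII, (2.51) p.232 (bookkeeping: the two typings)] -/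
theorem conv348_oneCubeYF_knitPins_of_regYR_section (hN : 1 ≤ N) (𝔏 : LettersY N θ Mstar)
    (hP : ∀ x : MemberY θ.d₆ θ.ℓ₆ θ.hd' θ.hL' θ.b₀ θ.b₁ Mstar, (𝔏 x).parS = parKnitY x.toKIdx)
    (hGp : ∀ x : MemberY θ.d₆ θ.ℓ₆ θ.hd' θ.hL' θ.b₀ θ.b₁ Mstar, (𝔏 x).Gp = GpY x.toKIdx (parKnitY x.toKIdx))
    {R₁ R₂ : RegFamY θ.d₆ θ.ℓ₆ θ.hd' θ.hL' θ.b₀ θ.b₁ Mstar (Matrix (Fin N) (Fin N) ℂ)} {c : ℝ} (hc : 0 < c)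
    (hRP1 : ∀ (x : MemberY θ.d₆ θ.ℓ₆ θ.hd' θ.hL' θ.b₀ θ.b₁ Mstar) (α₀ : ℝ)
      (U : (bg9YR (Matrix (Fin N) (Fin N) ℂ) (specialUnitaryUnits (Fin N)) R₁ R₂ x).Cfg),
      (bg9YR (Matrix (Fin N) (Fin N) ℂ) (specialUnitaryUnits (Fin N)) R₁ R₂ x).Reg335 c α₀ U →
        0 ≤ α₀ ∧ (bg9YP (Matrix (Fin N) (Fin N) ℂ) (specialUnitaryUnits (Fin N)) x).Reg335 c35Y α₀ U) :
    ∃ M₁ a₁ B₀ δ₀ : ℝ, 0 < M₁ ∧ 0 < a₁ ∧ 0 < B₀ ∧ 0 < δ₀ ∧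
    ∀ (bI : ∀ x : MemberY θ.d₆ θ.ℓ₆ θ.hd' θ.hL' θ.b₀ θ.b₁ Mstar, FBondY x.toKIdx → IBondY x.toKIdx)
      (_hβI : ∀ (x : MemberY θ.d₆ θ.ℓ₆ θ.hd' θ.hL' θ.b₀ θ.b₁ Mstar) (f : FBondY x.toKIdx) (c : IBondY x.toKIdx),
        blkV1 x.hN x.D f = β x.hN x.D x.hk c → β x.hN x.D x.hk (bI x f) = blkV1 x.hN x.D f)
      (x : MemberY θ.d₆ θ.ℓ₆ θ.hd' θ.hL' θ.b₀ θ.b₁ Mstar), Function.Surjective (β x.hN x.D x.hk) → M₁ ≤ (geo9Y x).M →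
      ∀ α₀ : ℝ, 0 < α₀ → c * (geo9Y x).M * α₀ ≤ a₁ →
      ∀ U : (bg9YR (Matrix (Fin N) (Fin N) ℂ) (specialUnitaryUnits (Fin N)) R₁ R₂ x).Cfg,
        (bg9YR (Matrix (Fin N) (Fin N) ℂ) (specialUnitaryUnits (Fin N)) R₁ R₂ x).Reg335 c α₀ U →
        Conv348Blk (oneCubeOps39YF θ Mstar 𝔏 bI x) B₀ δ₀ U := by
  obtain ⟨M₁, a₁, B₀, δ₀, hM₁, ha₁, hB₀, hδ₀, h⟩ := conv348_oneCubeYFR_knitPins_of_regYR_section (N := N) θ Mstar hN 𝔏 hP hGp hc hRP1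
  exact ⟨M₁, a₁, B₀, δ₀, hM₁, ha₁, hB₀, hδ₀, fun bI hβI x hsurj hM α₀ hα ha U hU =>
    (B9Thm39FacesAtLettersRC.conv348Blk_oneCubeYFR_iff θ Mstar 𝔏 R₁ R₂ bI x B₀ δ₀ U).1 (h bI hβI x hsurj hM α₀ hα ha U hU)⟩

end Rows1516

/-! ## §2 Row 17's guarded unit at a face-given averaging pair (dag-n06-c's knit Sect.-B step shape) -/

section Row17

variable [Nonempty (Fin N)]

/-- ★★ **n06-c's GUARDED `hunitA` AT A PAIR GIVEN BY ITS KNIT FACES, FOR ITS OWN SUB-FAMILIES** (`G := SU(N)`, `c35 := c35Y`): there are `MInv₀, aInv > 0` such that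
for every `MInv ≥ MInv₀`, every sub-family `f : J → MemberY …` with sections `(ιB, hι)`, every averaging pair `(𝔮, 𝔮s)` with the faces `𝔮 j U = QknitY (f j).toKIdx U`,
`𝔮s j U = adjTrY (QknitY (f j).toKIdx U)`, every `j`, `α₀`, `U`: `MInv ≤ M → 0 < α₀ → M·α₀ ≤ aInv → U ∈ (bg9YC 𝕄 SU(N) (extraYPb 𝕄 SU(N)) (f j)).Reg335 c₃₅ α₀ →
IsUnit (deltaAQY (f j).toKIdx (𝔮 j) (𝔮s j) (parKnitY (f j).toKIdx) (GpY (f j).toKIdx (parKnitY (f j).toKIdx)) U)` — `Δ_a[𝔮](U)` reads the pair only through `𝔮 U`, `𝔮s U`,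
where it IS the pair of record. [cite: Balaban1985BackgroundPropagators, Thm 3.11 p.416 + (3.26)–(3.27) p.395 + (3.19) p.393 + (3.11)–(3.13) p.392 + (3.14)–(3.15) p.393 + (3.35) p.396 + (3.115) p.418; Balaban1985Averaging, (15)–(23) pp.19–21, Prop. 2 (52)–(53) p.26] -/
theorem hunitAQ_knitFaces_of_sections : ∃ MInv₀ aInv : ℝ, 0 < MInv₀ ∧ 0 < aInv ∧
    ∀ (MInv : ℝ), MInv₀ ≤ MInv →
    ∀ {J : Type} (f : J → MemberY θ.d₆ θ.ℓ₆ θ.hd' θ.hL' θ.b₀ θ.b₁ Mstar) (ιB : ∀ j : J, BlkY (f j).toKIdx → IBondY (f j).toKIdx)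
      (_hι : ∀ (j : J) (s : BlkY (f j).toKIdx), β (f j).toKIdx.hN (f j).toKIdx.D (f j).toKIdx.hk (ιB j s) = s)
      (𝔮 : ∀ j : J, CfgY (Matrix (Fin N) (Fin N) ℂ) (f j).toKIdx →
        ((FBondY (f j).toKIdx → Matrix (Fin N) (Fin N) ℂ) →ₗ[ℂ] (IBondY (f j).toKIdx → Matrix (Fin N) (Fin N) ℂ)))
      (𝔮s : ∀ j : J, CfgY (Matrix (Fin N) (Fin N) ℂ) (f j).toKIdx →
        ((IBondY (f j).toKIdx → Matrix (Fin N) (Fin N) ℂ) →ₗ[ℂ] (FBondY (f j).toKIdx → Matrix (Fin N) (Fin N) ℂ)))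
      (_h𝔮 : ∀ (j : J) (U : CfgY (Matrix (Fin N) (Fin N) ℂ) (f j).toKIdx), 𝔮 j U = QknitY (f j).toKIdx U)
      (_h𝔮s : ∀ (j : J) (U : CfgY (Matrix (Fin N) (Fin N) ℂ) (f j).toKIdx), 𝔮s j U = adjTrY (QknitY (f j).toKIdx U))
      (j : J) (α₀ : ℝ) (U : CfgY (Matrix (Fin N) (Fin N) ℂ) (f j).toKIdx),
      MInv ≤ (geo9Y (f j)).M → 0 < α₀ → (geo9Y (f j)).M * α₀ ≤ aInv →
      (bg9YC (Matrix (Fin N) (Fin N) ℂ) (specialUnitaryUnits (Fin N))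
          (extraYPb (Matrix (Fin N) (Fin N) ℂ) (specialUnitaryUnits (Fin N))) (f j)).Reg335 c35Y α₀ U →
      IsUnit (deltaAQY (f j).toKIdx (𝔮 j) (𝔮s j) (parKnitY (f j).toKIdx) (GpY (f j).toKIdx (parKnitY (f j).toKIdx)) U) := by
  obtain ⟨M₁, a₁, hM₁, ha₁, h⟩ := isUnit_deltaAQY_knitRecord_at_scMember (N := N) θ Mstar
  refine ⟨M₁, a₁, hM₁, ha₁, fun MInv hMInv J f ιB hι 𝔮 𝔮s h𝔮 h𝔮s j α₀ U hM hα ha hU => ?_⟩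
  have hP : (bg9YP (Matrix (Fin N) (Fin N) ℂ) (specialUnitaryUnits (Fin N)) (f j)).Reg335 c35Y α₀ U := ⟨⟨hU.1.1, hU.1.2.2⟩, hU.2⟩
  have e : deltaAQY (f j).toKIdx (𝔮 j) (𝔮s j) (parKnitY (f j).toKIdx) (GpY (f j).toKIdx (parKnitY (f j).toKIdx)) U =
      deltaAQY (f j).toKIdx (qKnitOfRecord N θ (f j).toKIdx) (qsKnitOfRecord N θ (f j).toKIdx) (parKnitY (f j).toKIdx)
        (GpY (f j).toKIdx (parKnitY (f j).toKIdx)) U := by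
    unfold deltaAQY
    rw [h𝔮 j U, h𝔮s j U]
    rfl
  rw [e]
  exact h (f j) (fun s => ⟨ιB j s, hι j s⟩) (hMInv.trans hM) α₀ hα ha U hP

end Row17

end Literature.MathematicalPhysics.QuantumFieldTheory.Balaban1983to89.B9KnitRows1517AtPinnedShapesY

end
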